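import Literature.Geometry.Lorentzian.CauchyHypersurfaceCausalProofs
import Mathlib.Topology.Instances.AddCircle.Defs
import HarnessLib

/-!
# A spacetime with a Cauchy hypersurface is chronological (O'Neill 1983, Ch. 14, Cor. 14.39)

For a time-oriented Lorentzian manifold `(M, g, τ)` on a Hausdorff manifold (any model, any
regularity of the metric) we prove:

* `LorentzianMetric.IsCauchyHypersurface.isChronological` — **if `M` has a Cauchy hypersurface
  (`IsCauchyHypersurface`: met exactly once by every endless timelike curve), then `M` contains no
  closed timelike curve** (`IsChronological`).

This is the chronology half of "a Cauchy development is strongly causal" (O'Neill 1983, Ch. 14,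
Lemma 14.37, Thm. 14.38, Cor. 14.39; Hawking–Ellis 1973, §6.5–6.6, Prop. 6.6.3), the first clause of
global hyperbolicity in the Bernal–Sánchez form used by the tree (`IsGloballyHyperbolic`), here for
timelike loops. The printed proofs traverse a closed causal curve infinitely often to obtain an
inextendible causal curve missing (or meeting infinitely often) the hypersurface; for the tree's
everywhere-differentiable curves the loop must first be made `C¹`-periodic: a closed timelike curve
`δ` from `p` to `p` is re-cut at a middle point `q = δ m` and its corner at `p` rounded with germ
control (`exists_isFutureTimelikeCurveOn_splice`), giving a timelike `γ` on `[m, m + P]` with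
`γ (u + P) = γ u` for `u` near `m`; the periodic curve `Γ t = γ (toIcoMod P m t)` is locally a
translate of `γ`, hence an everywhere-differentiable future timelike curve on `ℝ`; it is endless
in both directions, since it takes the value `q` and a value `≠ q` periodically
(`exists_ne_of_isFutureTimelikeCurveOn`: a timelike curve is not constant to the right of a
parameter — its chart derivative is nonzero); so it meets the Cauchy hypersurface at exactly one
parameter `t` — and at `t + P`.

Everything is proved; no definitions and no named facts (D-0026).

## References

* B. O'Neill, *Semi-Riemannian geometry with applications to relativity*, Academic Press 1983,
  Ch. 14, Lemma 14.37, Thm. 14.38, Cor. 14.39 (pp. 422–423). [ONeillSemiRiemannian1983]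
* S. W. Hawking, G. F. R. Ellis, *The large scale structure of space-time*, CUP 1973, §6.5–6.6,
  Prop. 6.6.3. [HawkingEllis1973CUP]
-/

noncomputable section

open Bundle Set Filter Function Topology
open scoped Manifold ContDiff Topology

namespace Literature.Geometry.Lorentzian

variable {E : Type*} [NormedAddCommGroup E] [NormedSpace ℝ E] {H : Type*} [TopologicalSpace H]
  {I : ModelWithCorners ℝ E H} {n : ℕ∞ω} {M : Type*} [TopologicalSpace M] [ChartedSpace H M]
  [IsManifold I ∞ M]

namespace LorentzianMetric

variable {g : LorentzianMetric I n M} {τ : TimeOrientation g}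

/-! ### A timelike curve is not locally constant -/

/-- **A future timelike curve is not constant to the right of any of its parameters**: if `γ` is
differentiable at `m` with timelike (hence nonzero) velocity, it is not constant on any
`[m, m + P)`, `P > 0` (read the curve in the chart at `γ m`: its derivative there is the nonzero
coordinate image of the velocity, while a function constant on `[m, m + P)` has right derivative
`0`). [folklore] -/
theorem exists_ne_of_isFutureTimelikeCurveOn {γ : ℝ → M} {s : Set ℝ}
    (hγ : g.IsFutureTimelikeCurveOn τ γ s) {m : ℝ} (hm : m ∈ s) {P : ℝ} (hP : 0 < P) :
    ∃ u ∈ Ioo m (m + P), γ u ≠ γ m := by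
  by_contra hcon
  push Not at hcon
  obtain ⟨hd, htl, -⟩ := hγ m hm
  set eT := trivializationAt E (TangentSpace I) (γ m) with heT
  set w : E := eT.continuousLinearMapAt ℝ (γ m) (velocity I γ m) with hw
  have hderiv : HasDerivAt (extChartAt I (γ m) ∘ γ) w m :=
    hasDerivAt_extChartAt_comp_continuousLinearMapAt (p := γ m) hd (mem_chart_source H (γ m))
  -- `w ≠ 0`
  have hb : γ m ∈ eT.baseSet := by
    rw [heT, TangentBundle.trivializationAt_baseSet]; exact mem_chart_source H (γ m)
  have hw0 : w ≠ 0 := by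
    intro h0
    have h1 : eT.symmL ℝ (γ m) w = velocity I γ m := eT.symmL_continuousLinearMapAt hb _
    rw [h0, map_zero] at h1
    exact (IsTimelike.ne_zero g htl) h1.symm
  -- the chart curve is constant on `[m, m + P)`, so its right derivative vanishes
  have hconst : HasDerivWithinAt (extChartAt I (γ m) ∘ γ) 0 (Ici m) m := by
    have h0 : HasDerivWithinAt (fun _ : ℝ ↦ extChartAt I (γ m) (γ m)) 0 (Ici m) m :=
      hasDerivWithinAt_const m (Ici m) _
    refine h0.congr_of_eventuallyEq_of_mem ?_ (self_mem_Ici)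
    have : Ico m (m + P) ∈ 𝓝[Ici m] m := Ico_mem_nhdsGE (by linarith)
    filter_upwards [this] with u hu
    rcases hu.1.eq_or_lt with h | h
    · simp only [comp_apply, ← h]
    · simp only [comp_apply, hcon u ⟨h, hu.2⟩]
  have huniq : w = 0 :=
    (uniqueDiffOn_Ici m m self_mem_Ici).eq_deriv _ hderiv.hasDerivWithinAt hconst
  exact hw0 huniq

/-! ### The chronology condition -/

section Chronology

variable [T2Space M]

/-- **A spacetime with a Cauchy hypersurface is chronological** (no closed timelike curves).
O'Neill 1983, Ch. 14, Lemma 14.37 with Cor. 14.39 (a Cauchy development `D(S)`, in particular a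
spacetime with a Cauchy hypersurface, is strongly causal, hence causal and chronological);
Hawking–Ellis 1973, §6.5–6.6. Proof (no limit curves): a closed timelike curve `δ` from `p` to `p`
is re-cut at a middle point `q = δ m` and its corner at `p` rounded
(`exists_isFutureTimelikeCurveOn_splice`), giving a timelike curve `γ` on `[m, m + P]` with
`γ m = γ (m + P) = q` *whose germs at the two ends agree* (`γ (u + P) = γ u` near `m`); the
`P`-periodic curve `Γ t = γ (toIcoMod P m t)` is then an everywhere-differentiable future timelike
curve on `ℝ`, endless in both directions (it takes the value `q` and some value `≠ q`
periodically), so it meets the Cauchy hypersurface exactly once — but with `t` also at `t + P`.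
[cite: ONeillSemiRiemannian1983, Ch. 14, Lemma 14.37 and Cor. 14.39 (pp. 422–423); HawkingEllis1973CUP, §6.5] -/
theorem IsCauchyHypersurface.isChronological {S : Set M} (hS : g.IsCauchyHypersurface τ S) :
    g.IsChronological τ := by
  intro δ a b hab hδ heq
  -- re-cut the loop at the middle point and round the corner at `p = δ a = δ b`
  set m : ℝ := (a + b) / 2 with hm_def
  have ham : a < m := by rw [hm_def]; linarith
  have hmb : m < b := by rw [hm_def]; linarith
  obtain ⟨γ, L, c, hL, h1, h2, hγ, hγleft, hγright⟩ :=
    exists_isFutureTimelikeCurveOn_splice (q := δ b) hmb (hδ.mono (Icc_subset_Icc ham.le le_rfl))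
      rfl ham (hδ.mono (Icc_subset_Icc le_rfl hmb.le)) heq
  -- the period
  set P : ℝ := -c with hP_def
  have hP : 0 < P := by rw [hP_def]; linarith
  have hmP : m + P = m - c := by rw [hP_def]; ring
  have hγ' : g.IsFutureTimelikeCurveOn τ γ (Icc m (m + P)) := by rw [hmP]; exact hγ
  -- the germs at `m` and `m + P` agree
  have hper : ∀ u ∈ Icc (b + L + c) b, γ (u + P) = γ u := by
    intro u hu
    rw [hγright (u + P) (by rw [hP_def]; linarith [hu.1]), hγleft u hu.2]
    congr 1
    rw [hP_def]; ring
  have hperm : ∀ᶠ u in 𝓝 m, γ (u + P) = γ u := by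
    filter_upwards [Icc_mem_nhds h2 hmb] with u hu using hper u hu
  obtain ⟨ε₀, hε₀, hε₀P⟩ : ∃ ε₀ > 0, ∀ u, dist u m < ε₀ → γ (u + P) = γ u :=
    Metric.eventually_nhds_iff.1 hperm
  -- the periodic curve
  set Γ : ℝ → M := fun t ↦ γ (toIcoMod hP m t) with hΓ_def
  -- locally `Γ` is a translate of `γ`
  have hloc : ∀ t₀ : ℝ, ∃ k : ℤ, t₀ - k • P ∈ Ico m (m + P) ∧
      Γ =ᶠ[𝓝 t₀] fun t ↦ γ (t - k • P) := by
    intro t₀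
    set k : ℤ := toIcoDiv hP m t₀ with hk
    have hu₀ : t₀ - k • P = toIcoMod hP m t₀ := self_sub_toIcoDiv_zsmul hP m t₀
    have hu₀I : t₀ - k • P ∈ Ico m (m + P) := by rw [hu₀]; exact toIcoMod_mem_Ico hP m t₀
    refine ⟨k, hu₀I, ?_⟩
    have hmod : ∀ t, t - k • P ∈ Ico m (m + P) → toIcoMod hP m t = t - k • P := fun t ht ↦
      (toIcoMod_eq_iff hP).2 ⟨ht, k, by ring⟩
    have hmod' : ∀ t, t - k • P + P ∈ Ico m (m + P) → toIcoMod hP m t = t - k • P + P := fun t ht ↦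
      (toIcoMod_eq_iff hP).2 ⟨ht, k - 1, by rw [sub_smul, one_smul]; ring⟩
    rcases hu₀I.1.eq_or_lt with h0 | h0
    · -- jump point: `t₀ - k P = m`
      have hev : ∀ᶠ t in 𝓝 t₀, dist t t₀ < min ε₀ P := Metric.ball_mem_nhds t₀ (lt_min hε₀ hP)
      filter_upwards [hev] with t ht
      have ht' : |t - t₀| < min ε₀ P := by rwa [Real.dist_eq] at ht
      have htε : |t - t₀| < ε₀ := ht'.trans_le (min_le_left _ _)
      have htP : |t - t₀| < P := ht'.trans_le (min_le_right _ _)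
      show γ (toIcoMod hP m t) = γ (t - k • P)
      by_cases hge : t₀ ≤ t
      · rw [hmod t ⟨by linarith [h0], by linarith [h0, (abs_lt.1 htP).2]⟩]
      · push Not at hge
        rw [hmod' t ⟨by linarith [h0, (abs_lt.1 htP).1], by linarith [h0]⟩]
        refine hε₀P (t - k • P) ?_
        rw [Real.dist_eq, show t - k • P - m = t - t₀ by linarith [h0]]
        exact htε
    · -- interior point
      have hev : ∀ᶠ t in 𝓝 t₀, t - k • P ∈ Ioo m (m + P) := by
        have hc : ContinuousAt (fun t : ℝ ↦ t - k • P) t₀ := (continuous_id.sub continuous_const).continuousAt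
        exact hc.preimage_mem_nhds (Ioo_mem_nhds h0 hu₀I.2)
      filter_upwards [hev] with t ht
      show γ (toIcoMod hP m t) = γ (t - k • P)
      rw [hmod t ⟨ht.1.le, ht.2⟩]
  -- `Γ` is a future timelike curve on `ℝ`
  have hΓ : g.IsFutureTimelikeCurveOn τ Γ univ := by
    intro t₀ _
    obtain ⟨k, hkI, hev⟩ := hloc t₀
    obtain ⟨hd, htl, hfd⟩ := hγ' (t₀ - k • P) ⟨hkI.1, hkI.2.le⟩
    have hφ : HasDerivAt (fun t : ℝ ↦ t - k • P) 1 t₀ := (hasDerivAt_id t₀).sub_const _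
    obtain ⟨hd', hv'⟩ := mdifferentiableAt_comp_of_hasDerivAt (γ := γ) (φ := fun t : ℝ ↦ t - k • P)
      hd hφ
    rw [one_smul] at hv'
    have hveq : velocity I Γ t₀ = velocity I γ (t₀ - k • P) := by
      rw [← hv']; exact velocity_congr_of_eventuallyEq (I := I) hev
    refine ⟨hev.mdifferentiableAt_iff.2 hd', ?_, ?_⟩
    · rw [hveq]
      have : Γ t₀ = γ (t₀ - k • P) := hev.eq_of_nhds
      rw [this]; exact htl
    · rw [hveq]
      have : Γ t₀ = γ (t₀ - k • P) := hev.eq_of_nhds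
      rw [this]; exact hfd
  -- two periodic families of values: `q = γ m` and some `γ u₁ ≠ q`
  obtain ⟨u₁, hu₁, hne⟩ := exists_ne_of_isFutureTimelikeCurveOn hγ' (left_mem_Icc.2 (by linarith)) hP
  have hΓm : ∀ j : ℤ, Γ (m + j • P) = γ m := fun j ↦ by
    show γ (toIcoMod hP m (m + j • P)) = γ m
    rw [toIcoMod_add_zsmul, toIcoMod_apply_left]
  have hΓu : ∀ j : ℤ, Γ (u₁ + j • P) = γ u₁ := fun j ↦ by
    show γ (toIcoMod hP m (u₁ + j • P)) = γ u₁
    rw [toIcoMod_add_zsmul, (toIcoMod_eq_self hP).2 ⟨hu₁.1.le, hu₁.2⟩]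
  have hseqTop : ∀ x₀ : ℝ, Tendsto (fun j : ℕ ↦ x₀ + (j : ℤ) • P) atTop atTop := fun x₀ ↦ by
    have h := tendsto_atTop_add_const_left atTop x₀
      ((tendsto_natCast_atTop_atTop (R := ℝ)).atTop_mul_const hP)
    refine h.congr fun j ↦ ?_
    simp [zsmul_eq_mul]
  have hseqBot : ∀ x₀ : ℝ, Tendsto (fun j : ℕ ↦ x₀ + (-(j : ℤ)) • P) atTop atBot := fun x₀ ↦ by
    have h := tendsto_atBot_add_const_left atTop x₀
      ((tendsto_neg_atTop_atBot.comp (tendsto_natCast_atTop_atTop (R := ℝ))).atBot_mul_const hP)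
    refine h.congr fun j ↦ ?_
    simp [zsmul_eq_mul]
  have hfe : IsFutureEndless Γ univ := by
    refine ⟨univ_nonempty, fun x hx ↦ hne ?_⟩
    rw [hasFutureEndpoint_iff_tendsto_atTop (subset_univ (Ici (0 : ℝ)))] at hx
    have h1 : Tendsto (fun j : ℕ ↦ Γ (m + (j : ℤ) • P)) atTop (𝓝 x) := hx.comp (hseqTop m)
    have h2 : Tendsto (fun j : ℕ ↦ Γ (u₁ + (j : ℤ) • P)) atTop (𝓝 x) := hx.comp (hseqTop u₁)
    simp only [hΓm, hΓu] at h1 h2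
    exact (tendsto_nhds_unique h2 tendsto_const_nhds).symm ▸
      (tendsto_nhds_unique h1 tendsto_const_nhds).symm ▸ rfl
  have hpe : IsPastEndless Γ univ := by
    refine ⟨univ_nonempty, fun x hx ↦ hne ?_⟩
    rw [hasPastEndpoint_iff_tendsto_atBot (subset_univ (Iic (0 : ℝ)))] at hx
    have h1 : Tendsto (fun j : ℕ ↦ Γ (m + (-(j : ℤ)) • P)) atTop (𝓝 x) := hx.comp (hseqBot m)
    have h2 : Tendsto (fun j : ℕ ↦ Γ (u₁ + (-(j : ℤ)) • P)) atTop (𝓝 x) := hx.comp (hseqBot u₁)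
    simp only [hΓm, hΓu] at h1 h2
    exact (tendsto_nhds_unique h2 tendsto_const_nhds).symm ▸
      (tendsto_nhds_unique h1 tendsto_const_nhds).symm ▸ rfl
  -- the Cauchy hypersurface is met exactly once, yet periodically
  obtain ⟨t, ⟨-, htS⟩, huniq⟩ := hS Γ univ ⟨ordConnected_univ, hΓ, hfe, hpe⟩
  have hper' : Γ (t + P) = Γ t := by
    show γ (toIcoMod hP m (t + P)) = γ (toIcoMod hP m t)
    rw [toIcoMod_add_right]
  have := huniq (t + P) ⟨mem_univ _, by rw [hper']; exact htS⟩
  linarith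

end Chronology

end LorentzianMetric

end Literature.Geometry.Lorentzian

end
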